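import Summits.MatrixMultiplication.MatrixMultiplication.Theorems.SoloInformedValTwoBlockCriterion

/-!
# Face inequalities for two-block configurations, II: the patterns `(a,a,b)` and `(a,b,b)`

Solo-informed MatrixMultiplication, gen 77 (dossier `paper/val-superlinear.md` §15.8 (k)); companion of
`SoloInformedValTwoBlockFaces` (pattern `(a,b,a)`).  For two complete blocks `X_a × Y_a × Z_a` (identity potentials
in a finite abelian group `G`) with the additive TPP:

* pattern `(1,1,2)` (`CrossFree X₁ Y₁ Y₁ Z₁ Z₂ X₂`) makes `Z₂ − X₂` disjoint from a translate of `Y₁ − X₁ + Z₁`,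
  whence `|X₁||Y₁||Z₁| + |Z₂||X₂| ≤ |G|` (`AddTPP.volume_add_faceZX_le`);
* pattern `(1,2,2)` (`CrossFree X₁ Y₁ Y₂ Z₂ Z₂ X₂`) makes `X₁ − Y₁` disjoint from a translate of `X₂ − Y₂ + Z₂`,
  whence `|X₂||Y₂||Z₂| + |X₁||Y₁| ≤ |G|` (`AddTPP.volume_add_faceXY_le`).

Consequently in a superlinear pair (`|G| < v₁ + v₂`) one gets `|Y₂| ≥ 2` and `|Z₁| ≥ 2`
(`AddTPP.two_le_card_Y_of_superlinear`, `AddTPP.two_le_card_Z_of_superlinear`); together with part I and the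
block/index symmetry, every side of both blocks is at least two.

Elementary; no `sorry`.
-/

namespace Summit.MatrixMultiplication.MatrixMultiplication.Theorems.SoloVal

open Finset

section TwoBlockFacesB

variable {G : Type*} [AddCommGroup G] [DecidableEq G]

/-- Under the additive TPP the map `(x, y, z) ↦ g + (y - x + z)` is injective on `X × Y × Z`. -/
theorem AddTPP.card_image_translate₂ {X Y Z : Finset G} (h : AddTPP X Y Z) (g : G) :
    ((X ×ˢ Y ×ˢ Z).image (fun t => g + (t.2.1 - t.1 + t.2.2))).card = X.card * Y.card * Z.card := by
  have hinj : Set.InjOn (fun t : G × G × G => g + (t.2.1 - t.1 + t.2.2)) ↑(X ×ˢ Y ×ˢ Z) := by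
    rintro ⟨x, y, z⟩ hm ⟨x', y', z'⟩ hm' heq
    simp only [Finset.coe_product, Set.mem_prod, Finset.mem_coe] at hm hm'
    have heq' : y - x + z = y' - x' + z' := add_left_cancel heq
    have h0 : (x' - y') + (y - z') + (z - x) = 0 := by
      rw [← sub_eq_zero] at heq'
      calc (x' - y') + (y - z') + (z - x) = y - x + z - (y' - x' + z') := by abel
        _ = 0 := heq'
    obtain ⟨hx, hy, hz⟩ := h hm'.1 hm.1 hm'.2.1 hm.2.1 hm'.2.2 hm.2.2 h0
    rw [hx, hy, hz]
  rw [Finset.card_image_of_injOn hinj, Finset.card_product, Finset.card_product, Nat.mul_assoc]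

/-- Under the additive TPP the map `(x, y, z) ↦ g + (x - y + z)` is injective on `X × Y × Z`. -/
theorem AddTPP.card_image_translate₃ {X Y Z : Finset G} (h : AddTPP X Y Z) (g : G) :
    ((X ×ˢ Y ×ˢ Z).image (fun t => g + (t.1 - t.2.1 + t.2.2))).card = X.card * Y.card * Z.card := by
  have hinj : Set.InjOn (fun t : G × G × G => g + (t.1 - t.2.1 + t.2.2)) ↑(X ×ˢ Y ×ˢ Z) := by
    rintro ⟨x, y, z⟩ hm ⟨x', y', z'⟩ hm' heq
    simp only [Finset.coe_product, Set.mem_prod, Finset.mem_coe] at hm hm'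
    have heq' : x - y + z = x' - y' + z' := add_left_cancel heq
    have h0 : (x - y) + (y' - z') + (z - x') = 0 := by
      rw [← sub_eq_zero] at heq'
      calc (x - y) + (y' - z') + (z - x') = x - y + z - (x' - y' + z') := by abel
        _ = 0 := heq'
    obtain ⟨hx, hy, hz⟩ := h hm.1 hm'.1 hm.2.1 hm'.2.1 hm'.2.2 hm.2.2 h0
    rw [hx, hy, hz]
  rw [Finset.card_image_of_injOn hinj, Finset.card_product, Finset.card_product, Nat.mul_assoc]

/-- Under the additive TPP (and `Y` non-empty) the map `(z, x) ↦ z - x` is injective on `Z × X`. -/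
theorem AddTPP.card_image_sub_ZX {X Y Z : Finset G} (h : AddTPP X Y Z) (hY : Y.Nonempty) :
    ((Z ×ˢ X).image (fun p => p.1 - p.2)).card = Z.card * X.card := by
  obtain ⟨y₀, hy₀⟩ := hY
  have hinj : Set.InjOn (fun p : G × G => p.1 - p.2) ↑(Z ×ˢ X) := by
    rintro ⟨z, x⟩ hm ⟨z', x'⟩ hm' heq
    simp only [Finset.coe_product, Set.mem_prod, Finset.mem_coe] at hm hm'
    have heq' : z - x = z' - x' := heq
    have h0 : (x' - y₀) + (y₀ - z') + (z - x) = 0 := by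
      rw [← sub_eq_zero] at heq'
      calc (x' - y₀) + (y₀ - z') + (z - x) = z - x - (z' - x') := by abel
        _ = 0 := heq'
    obtain ⟨hx, -, hz⟩ := h hm'.2 hm.2 hy₀ hy₀ hm'.1 hm.1 h0
    rw [hx, hz]
  rw [Finset.card_image_of_injOn hinj, Finset.card_product]

/-- Under the additive TPP (and `Z` non-empty) the map `(x, y) ↦ x - y` is injective on `X × Y`. -/
theorem AddTPP.card_image_sub_XY {X Y Z : Finset G} (h : AddTPP X Y Z) (hZ : Z.Nonempty) :
    ((X ×ˢ Y).image (fun p => p.1 - p.2)).card = X.card * Y.card := by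
  obtain ⟨z₀, hz₀⟩ := hZ
  have hinj : Set.InjOn (fun p : G × G => p.1 - p.2) ↑(X ×ˢ Y) := by
    rintro ⟨x, y⟩ hm ⟨x', y'⟩ hm' heq
    simp only [Finset.coe_product, Set.mem_prod, Finset.mem_coe] at hm hm'
    have heq' : x - y = x' - y' := heq
    have h0 : (x - y) + (y' - z₀) + (z₀ - x') = 0 := by
      rw [← sub_eq_zero] at heq'
      calc (x - y) + (y' - z₀) + (z₀ - x') = x - y - (x' - y') := by abel
        _ = 0 := heq'
    obtain ⟨hx, hy, -⟩ := h hm.1 hm'.1 hm.2 hm'.2 hz₀ hz₀ h0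
    rw [hx, hy]
  rw [Finset.card_image_of_injOn hinj, Finset.card_product]

/-- FACE INEQUALITY, pattern `(1,1,2)`: `|X₁||Y₁||Z₁| + |Z₂||X₂| ≤ |G|`. -/
theorem AddTPP.volume_add_faceZX_le [Fintype G] {X₁ Y₁ Z₁ X₂ Y₂ Z₂ : Finset G}
    (h1 : AddTPP X₁ Y₁ Z₁) (h2 : AddTPP X₂ Y₂ Z₂) (hY₁ : Y₁.Nonempty) (hY₂ : Y₂.Nonempty)
    (hc : CrossFree X₁ Y₁ Y₁ Z₁ Z₂ X₂) :
    X₁.card * Y₁.card * Z₁.card + Z₂.card * X₂.card ≤ Fintype.card G := by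
  obtain ⟨y₀, hy₀⟩ := hY₁
  set S := (X₁ ×ˢ Y₁ ×ˢ Z₁).image (fun t => -y₀ + (t.2.1 - t.1 + t.2.2)) with hS
  set B := (Z₂ ×ˢ X₂).image (fun p => p.1 - p.2) with hB
  have hSc : S.card = X₁.card * Y₁.card * Z₁.card := h1.card_image_translate₂ (-y₀)
  have hBc : B.card = Z₂.card * X₂.card := h2.card_image_sub_ZX hY₂
  have hdisj : Disjoint S B := by
    rw [Finset.disjoint_left]
    intro g hgS hgB
    rw [hS, Finset.mem_image] at hgS
    rw [hB, Finset.mem_image] at hgB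
    obtain ⟨⟨x, y, z⟩, hm, rfl⟩ := hgS
    obtain ⟨⟨z', x'⟩, hm', heq⟩ := hgB
    simp only [Finset.mem_product] at hm hm'
    have heq' : z' - x' = -y₀ + (y - x + z) := heq
    refine hc hm.1 hm.2.1 hy₀ hm.2.2 hm'.1 hm'.2 ?_
    rw [heq']
    abel
  calc X₁.card * Y₁.card * Z₁.card + Z₂.card * X₂.card = (S.disjUnion B hdisj).card := by
        rw [Finset.card_disjUnion, hSc, hBc]
    _ ≤ Fintype.card G := Finset.card_le_univ _

/-- FACE INEQUALITY, pattern `(1,2,2)`: `|X₂||Y₂||Z₂| + |X₁||Y₁| ≤ |G|`. -/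
theorem AddTPP.volume_add_faceXY_le [Fintype G] {X₁ Y₁ Z₁ X₂ Y₂ Z₂ : Finset G}
    (h1 : AddTPP X₁ Y₁ Z₁) (h2 : AddTPP X₂ Y₂ Z₂) (hZ₁ : Z₁.Nonempty) (hZ₂ : Z₂.Nonempty)
    (hc : CrossFree X₁ Y₁ Y₂ Z₂ Z₂ X₂) :
    X₂.card * Y₂.card * Z₂.card + X₁.card * Y₁.card ≤ Fintype.card G := by
  obtain ⟨z₀, hz₀⟩ := hZ₂
  set S := (X₂ ×ˢ Y₂ ×ˢ Z₂).image (fun t => -z₀ + (t.1 - t.2.1 + t.2.2)) with hS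
  set B := (X₁ ×ˢ Y₁).image (fun p => p.1 - p.2) with hB
  have hSc : S.card = X₂.card * Y₂.card * Z₂.card := h2.card_image_translate₃ (-z₀)
  have hBc : B.card = X₁.card * Y₁.card := h1.card_image_sub_XY hZ₁
  have hdisj : Disjoint S B := by
    rw [Finset.disjoint_left]
    intro g hgS hgB
    rw [hS, Finset.mem_image] at hgS
    rw [hB, Finset.mem_image] at hgB
    obtain ⟨⟨x', y', z⟩, hm, rfl⟩ := hgS
    obtain ⟨⟨x, y⟩, hm', heq⟩ := hgB
    simp only [Finset.mem_product] at hm hm'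
    have heq' : x - y = -z₀ + (x' - y' + z) := heq
    refine hc hm'.1 hm'.2 hm.2.1 hm.2.2 hz₀ hm.1 ?_
    rw [heq']
    abel
  calc X₂.card * Y₂.card * Z₂.card + X₁.card * Y₁.card = (S.disjUnion B hdisj).card := by
        rw [Finset.card_disjUnion, hSc, hBc]
    _ ≤ Fintype.card G := Finset.card_le_univ _

/-- Superlinear pair, pattern `(1,1,2)`: `|Y₂| ≥ 2`. -/
theorem AddTPP.two_le_card_Y_of_superlinear [Fintype G] {X₁ Y₁ Z₁ X₂ Y₂ Z₂ : Finset G}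
    (h1 : AddTPP X₁ Y₁ Z₁) (h2 : AddTPP X₂ Y₂ Z₂) (hY₁ : Y₁.Nonempty) (hY₂ : Y₂.Nonempty)
    (hc : CrossFree X₁ Y₁ Y₁ Z₁ Z₂ X₂)
    (hsup : Fintype.card G < X₁.card * Y₁.card * Z₁.card + X₂.card * Y₂.card * Z₂.card) :
    2 ≤ Y₂.card := by
  have hf := h1.volume_add_faceZX_le h2 hY₁ hY₂ hc
  by_contra hlt
  have hle : X₂.card * Y₂.card * Z₂.card ≤ Z₂.card * X₂.card :=
    calc X₂.card * Y₂.card * Z₂.card = Y₂.card * (Z₂.card * X₂.card) := by ring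
      _ ≤ 1 * (Z₂.card * X₂.card) := Nat.mul_le_mul_right _ (by omega)
      _ = Z₂.card * X₂.card := one_mul _
  omega

/-- Superlinear pair, pattern `(1,2,2)`: `|Z₁| ≥ 2`. -/
theorem AddTPP.two_le_card_Z_of_superlinear [Fintype G] {X₁ Y₁ Z₁ X₂ Y₂ Z₂ : Finset G}
    (h1 : AddTPP X₁ Y₁ Z₁) (h2 : AddTPP X₂ Y₂ Z₂) (hZ₁ : Z₁.Nonempty) (hZ₂ : Z₂.Nonempty)
    (hc : CrossFree X₁ Y₁ Y₂ Z₂ Z₂ X₂)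
    (hsup : Fintype.card G < X₁.card * Y₁.card * Z₁.card + X₂.card * Y₂.card * Z₂.card) :
    2 ≤ Z₁.card := by
  have hf := h1.volume_add_faceXY_le h2 hZ₁ hZ₂ hc
  by_contra hlt
  have hle : X₁.card * Y₁.card * Z₁.card ≤ X₁.card * Y₁.card :=
    calc X₁.card * Y₁.card * Z₁.card = Z₁.card * (X₁.card * Y₁.card) := by ring
      _ ≤ 1 * (X₁.card * Y₁.card) := Nat.mul_le_mul_right _ (by omega)
      _ = X₁.card * Y₁.card := one_mul _
  omega

end TwoBlockFacesB

end Summit.MatrixMultiplication.MatrixMultiplication.Theorems.SoloVal
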